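import Summits.AtomisticToContinuum.Crystallization.Theorems.OverbindingBudgetHarmonicNormalForm

/-!
# Item `OverbindingBudget.RobustDefectLimitWindows` (stmt-AtomisticToContinuum-31280), slot 3 `TameBalancedDeepScaleGap (122/125) 0 4 (3/50) (1/450)`:
# the FINITE polytype-stability slot `K_M` and cone XLVIII (addendum to `OverbindingBudgetHarmonicNormalForm`)

decomp-a2c lens-4, generation 41 → 42 (census TAG 193 §4(a)(b), critic row 618 (A)).  The harmonic normal form of slot 3
(`OverbindingBudgetHarmonicNormalForm`: TBDSG ⟸ F ∧ MID, F ⟸ K ∧ R ∧ B) types K = `HarmonicPolytypeStability` as a `∀`-statement over ALL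
Hägg sequences and all finitely supported fields.  B only ever applies K on one deep ball, i.e. to fields supported in `M(ρ₁)` consecutive
close-packed layers; and since `4 · a√(2/3) > 3` a radius-3 pair spans at most 3 layers, that restricted statement `K_M` is implied by Bloch
positivity for the finitely many periodic Hägg words of period `M + 5` (periodisation lemma; `V_χ` analogue proved in tree:
`PricedLinkCensusTruncatedCensusGap.harmonicCoercivityWindow_of_periodic`, interface `latticeForm_nonneg_of_unitTorusSymbol`).  This file
types `K_M` (`HarmonicPolytypeStabilityLayers M`), the seams `K → K_M`, `K_{M'} → K_M` (`M ≤ M'`), the consumer `B_M`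
(`HarmonicReductionLayers M ρ₁`, with `B_M → B` and `target → B_M`), and the cones `K_M → R → B_M → MidAll → TBDSG` and XLVIII (record,
eight slots).  Float evidence for K (hence every `K_M`): inf λ = 4.5196 (fcc, `a = 1`, Γ-limit; census TAG 193, 25 words × a-grid, 0/414
interior minimisers).  Nothing here closes an item; all proofs are compositions. [this file; census TAG 193; critic row 618]
-/

namespace Summit.AtomisticToContinuum.Crystallization.Theorems.OverbindingBudgetHarmonicNormalForm

open Filter Metric Set Topology
open scoped BigOperators Classical
open Literature.MathematicalPhysics.StatisticalMechanics
open Summit.AtomisticToContinuum.Crystallization.Theses.OverbindingBudget (RobustDefectLimitWindows)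
open Summit.AtomisticToContinuum.Crystallization.Theses.PricedLinkCensus (ChargedEnergyGap)
open Summit.AtomisticToContinuum.Crystallization.Theorems.OverbindingBudgetGradedBareness (CleanlessExcessT)
open Summit.AtomisticToContinuum.Crystallization.Theorems.OverbindingBudgetCoherentCut (CoherentResidual)
open Summit.AtomisticToContinuum.Crystallization.Theorems.OverbindingBudgetTwoShellShape (TwoShellShape)
open Summit.AtomisticToContinuum.Crystallization.Theorems.OverbindingBudgetBalancedCensusStatements
open Summit.AtomisticToContinuum.Crystallization.Theorems.OverbindingBudgetBalancedCensusRecord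
/-! ## §1  The finite form `K_M` that B actually consumes

`4h = 4a√(2/3) ≥ 3.10 > 3`, so a radius-3 pair of a Barlow stacking spans at most 3 layers; hence K restricted to fields supported in
`≤ M` consecutive layers only ever sees `M + 6` consecutive letters of the Hägg word, and — every Hägg word agreeing on a finite block
with a periodic one — is implied by the Bloch inequality for the `2^(M+5)` periodic words of period `M + 5` (the periodisation lemma;
its `V_χ` analogue is PROVED in tree: `PricedLinkCensusTruncatedCensusGap.harmonicCoercivityWindow_of_periodic`, with the symbol-positivity
interface `latticeForm_nonneg_of_unitTorusSymbol` — the certificate of `K_M` should REUSE that apparatus).  B applies K only on deep balls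
(`≈ 2ρ₁/√(2/3) + 6` layers), so the consumable slot is `K_M`, CERT·FINITE; `K` itself stays as the clean `∀`-statement (TRUE-in-evidence:
inf λ = 4.5196 at fcc, `a = 1`, Γ-limit, census TAG 193; certification = analytic `λ(s) ≥ λ(fcc)` or transfer-matrix/LMI, not commissioned). -/

/-- **S1_M · `HarmonicPolytypeStabilityLayers M`** — K for displacement fields supported in at most `M` consecutive close-packed layers
(layer index read off the third coordinate, layer spacing `a√(2/3)`).  CERT·FINITE: ⟸ Bloch positivity for the periodic Hägg words of
period `M + 5` (periodisation lemma above). [census TAG 193 §4(a); critic row 618 (A)(a)] -/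
def HarmonicPolytypeStabilityLayers (M : ℕ) : Prop :=
  ∃ lam : ℝ, 0 < lam ∧ ∀ (a : ℝ), 19 / 20 ≤ a → a ≤ 1 → ∀ (s : ℤ → ℤ), IsHaggSeq s →
    ∀ (T : Finset (EuclideanSpace ℝ (Fin 3))),
      (↑T : Set (EuclideanSpace ℝ (Fin 3))) ⊆ barlowStacking a (a * Real.sqrt (2 / 3)) s →
      ∀ (w : EuclideanSpace ℝ (Fin 3) → EuclideanSpace ℝ (Fin 3)),
        (∀ x, w x ≠ 0 → x ∈ T ∧ ∀ z ∈ barlowStacking a (a * Real.sqrt (2 / 3)) s, dist x z ≤ 3 → z ∈ T) →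
        (∃ k₀ : ℤ, ∀ x, w x ≠ 0 →
            (k₀ : ℝ) * (a * Real.sqrt (2 / 3)) ≤ x 2 ∧ x 2 < ((k₀ : ℝ) + M) * (a * Real.sqrt (2 / 3))) →
        lam * (∑ x ∈ T, ∑ z ∈ T, if x ≠ z ∧ dist x z ≤ 101 / 100 * a then bondStretchSq (z - x) (w z - w x) else 0)
          ≤ ∑ x ∈ T, ∑ z ∈ T, if x ≠ z ∧ dist x z ≤ 3 then ljBondHess (z - x) (w z - w x) else 0

/-- Seam `K → K_M` (drop the layer-support hypothesis). [this file] -/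
theorem harmonicPolytypeStabilityLayers_of_stability (M : ℕ) (h : HarmonicPolytypeStability) :
    HarmonicPolytypeStabilityLayers M := by
  obtain ⟨lam, hlam, hK⟩ := h
  exact ⟨lam, hlam, fun a ha ha' s hs T hT w hw _ => hK a ha ha' s hs T hT w hw⟩

/-- `K_M` is antitone in `M` (a field supported in `≤ M` layers is supported in `≤ M'` layers for `M ≤ M'`). [this file] -/
theorem harmonicPolytypeStabilityLayers_anti {M M' : ℕ} (hMM' : M ≤ M') (h : HarmonicPolytypeStabilityLayers M') :
    HarmonicPolytypeStabilityLayers M := by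
  obtain ⟨lam, hlam, hK⟩ := h
  refine ⟨lam, hlam, fun a ha ha' s hs T hT w hw hlay => hK a ha ha' s hs T hT w hw ?_⟩
  obtain ⟨k₀, hk₀⟩ := hlay
  refine ⟨k₀, fun x hx => ⟨(hk₀ x hx).1, lt_of_lt_of_le (hk₀ x hx).2 ?_⟩⟩
  have hh : 0 ≤ a * Real.sqrt (2 / 3) := mul_nonneg (by linarith) (Real.sqrt_nonneg _)
  have : ((k₀ : ℝ) + M) ≤ ((k₀ : ℝ) + M') := by
    have : (M : ℝ) ≤ (M' : ℝ) := by exact_mod_cast hMM'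
    linarith
  exact mul_le_mul_of_nonneg_right this hh

/-- **S3_M · `HarmonicReductionLayers M ρ₁` («B_M»)** — B with the finite hypothesis `K_M` in place of `K`: the form a prover of B actually
establishes (B applies K on one deep ball, `M = M(ρ₁)` layers; `M(4) ≈ 11`).  `B_M → B` (`harmonicReduction_of_layers`); TRUE given the
target (`harmonicReductionLayers_of_target`).  Memo §5 step 3 (rev 3): hard cutoff at the fine-deep boundary (rebated), NO IMS against `λS`
(K has no mass term); the cross-chart gluing inside large fine-deep regions is B's hard step. [critic row 618 (A)(a)(b); this file] -/
def HarmonicReductionLayers (M : ℕ) (ρ₁ : ℝ) : Prop :=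
  HarmonicPolytypeStabilityLayers M → FineChartStraightening →
    ∃ ε₁ : ℝ, 0 < ε₁ ∧ TameBalancedDeepScaleGap (122 / 125) 0 ρ₁ ε₁ (1 / 450)

/-- `B_M → B`. [this file] -/
theorem harmonicReduction_of_layers {M : ℕ} {ρ₁ : ℝ} (h : HarmonicReductionLayers M ρ₁) : HarmonicReduction ρ₁ :=
  fun hK hR => h (harmonicPolytypeStabilityLayers_of_stability M hK) hR

/-- `B_M` is TRUE given the target (so it is on the weaker side, like B). [this file] -/
theorem harmonicReductionLayers_of_target (M : ℕ) {ρ₁ : ℝ} (hρ : 4 ≤ ρ₁)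
    (h : TameBalancedDeepScaleGap (122 / 125) 0 4 (3 / 50) (1 / 450)) : HarmonicReductionLayers M ρ₁ :=
  fun _ _ => ⟨3 / 50, by norm_num, fine_of_target le_rfl hρ h⟩

/-- **Slot-3 cone, finite-K form**: `K_M → R → B_M ρ₁ → MidAll ρ₁ → TBDSG`. [this file] -/
theorem tbdsg_of_harmonicLayers_midAll (M : ℕ) (ρ₁ : ℝ) (hK : HarmonicPolytypeStabilityLayers M) (hR : FineChartStraightening)
    (hB : HarmonicReductionLayers M ρ₁) (hM : MidAll ρ₁) : TameBalancedDeepScaleGap (122 / 125) 0 4 (3 / 50) (1 / 450) := by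
  obtain ⟨ε₁, hε₁, hF⟩ := hB hK hR
  have hF' : TameBalancedDeepScaleGap (122 / 125) 0 ρ₁ (min ε₁ (3 / 50)) (1 / 450) :=
    tameBalancedDeepScaleGap_anti_tol (min_le_left _ _) hF
  exact tameBalancedDeepScaleGap_of_fine_mid hF' (hM _ (lt_min hε₁ (by norm_num)) (min_le_right _ _))

/-- **CONE XLVIII (record, eight slots, finite K)** —
`ChargedEnergyGap → TwoShellShape (1/100) (3/50) (1/450) → K_M → R → B_M ρ₁ → MidAll ρ₁ → CleanlessExcessT → CoherentResidual 10 →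
RobustDefectLimitWindows`. [this file] -/
theorem rdef_of_ceg_shape_harmonicLayers_midAll (M : ℕ) (ρ₁ : ℝ) (hCEG : ChargedEnergyGap)
    (hT : TwoShellShape (1 / 100) (3 / 50) (1 / 450))
    (hK : HarmonicPolytypeStabilityLayers M) (hR : FineChartStraightening) (hB : HarmonicReductionLayers M ρ₁) (hM : MidAll ρ₁)
    (hCE : CleanlessExcessT) (hRes : CoherentResidual 10) : RobustDefectLimitWindows :=
  rdef_of_ceg_shape_balancedDeep_record hCEG hT (tbdsg_of_harmonicLayers_midAll M ρ₁ hK hR hB hM) hCE hRes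


end Summit.AtomisticToContinuum.Crystallization.Theorems.OverbindingBudgetHarmonicNormalForm
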